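import Summits.QuantumAdvantage.QuantumAdvantage.Theorems.InnerDegreeLawsA
import Summits.QuantumAdvantage.QuantumAdvantage.Theorems.DominoLawE

set_option linter.dupNamespace false

/-!
# InnerDegreeLawsC (lens 4, g27; part C of 4) — LAW S (a SHARED low-degree feature map is never perfect, via DominoLaw), first-moment subcube

Blocker `X = AbsorptionDial.NoPerfectPolyOdd` (item 28487); decomp-qadv lens 4 (minimal-counterexample / extremal reduction), g27.  The NODE record
(rung `QuadFormNoPerfectOdd`, residual `QuadLiftOdd`, sub-rung `OneQuadNoPerfectOdd`, floor `linFormFloor`, `x_iff_pieces`) lives in the cell file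
`g27/InnerDegreeDial.lean` and is NOT landed (Prop-definition node pieces); the tree parts are Prop-definition-free and state only unconditional LAWS.
Kernel-checked content:

* §6 **LAW S (`loss_of_sharedFeatures`, `loss_of_sharedQuad`; engine = g26's landed hitting law `DominoLaw.perfect_no_lowDeg_class`).**
  If ALL registers factor through the SAME `s` polynomial functions of degree `≤ D'` (a shared feature map / a common bottom layer of `s`
  `MOD_p∘AND_{D'}` gates) and `(12 s(p−1)D' + 6)(3 s(p−1)D' + 2) + 1 ≤ n`, the strategy is not perfect: shared bottom WIDTH·DEGREE must exceed
  `≈ √n/(6p)`.  At the quadratic grade: `k` shared linear forms + one shared quadratic never play perfectly for `n ≥ (24(k+1)(p−1)+6)(6(k+1)(p−1)+2)+1`.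
  The two engines are orthogonal: §2 needs linearisation on a subcube (sparse nonlinear parts; any per-register diversity), §6 needs a shared
  feature map (dense allowed; no diversity) — the rung's residual is «DENSE ∧ DIVERSE».
* §8 **first-moment subcube (`exists_card_avoiding`).**  `Σ_{b ∈ B} C(n−|b|, m−|b|) < C(n, m)` ⇒ an `m`-set containing no `b ∈ B`.
-/

open Finset
open Summit.QuantumAdvantage.AdviceFreeQNC0

namespace Summit.QuantumAdvantage.QuantumAdvantage.Theorems.InnerDegreeDial

/-! ### §6 LAW S: registers factoring through a SHARED low-degree feature map are never perfect (via g26's `DominoLaw.perfect_no_lowDeg_class`) -/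

section LawS

open Literature.Computability.MetaComplexity Literature.Computability.MetaComplexity.Smolensky

variable {p : ℕ} [Fact p.Prime] {n : ℕ}

/-- the indicator of a level set `{q = a}` of a polynomial function of degree `≤ D'` has degree `≤ (p−1)·D'` -/
theorem levelInd_mem_lowDeg {D' : ℕ} (q : CubeFn (ZMod p) n) (hq : q ∈ lowDeg (ZMod p) n D') (a : ZMod p) :
    (fun u => if q u = a then (1 : ZMod p) else 0) ∈ lowDeg (ZMod p) n ((p - 1) * D') := by
  have heq : (fun u => if q u = a then (1 : ZMod p) else 0) = 1 - (q - fun _ => a) ^ (p - 1) := by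
    funext u
    simp only [Pi.sub_apply, Pi.pow_apply, Pi.one_apply]
    exact ind_eq_const_eq _ a
  rw [heq]
  have hconst : (fun _ : Fin n → Bool => a) ∈ lowDeg (ZMod p) n D' := by
    have : (fun _ : Fin n → Bool => a) = a • (1 : CubeFn (ZMod p) n) := by
      funext u; simp
    rw [this]
    exact Submodule.smul_mem _ _ (one_mem_lowDeg D')
  have h1 : (q - fun _ => a) ∈ lowDeg (ZMod p) n D' := Submodule.sub_mem _ hq hconst
  exact Submodule.sub_mem _ (one_mem_lowDeg _) (pow_mem_lowDeg h1 (p - 1))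

/-- the joint level set of `s` polynomial functions of degree `≤ D'` is a Boolean function of `𝔽_p`-degree `≤ s·(p−1)·D'` -/
theorem hasDegF_jointLevel {s D' : ℕ} (q : Fin s → CubeFn (ZMod p) n) (hq : ∀ j, q j ∈ lowDeg (ZMod p) n D')
    (a : Fin s → ZMod p) : HasDegF p (fun u => decide (∀ j, q j u = a j)) (s * ((p - 1) * D')) := by
  classical
  unfold HasDegF
  have heq : (fun u : Fin n → Bool => if decide (∀ j, q j u = a j) = true then (1 : ZMod p) else 0)
      = ∏ j ∈ (univ : Finset (Fin s)), (fun u => if q j u = a j then (1 : ZMod p) else 0) := by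
    funext u
    rw [Finset.prod_apply]
    by_cases h : ∀ j, q j u = a j
    · rw [if_pos (decide_eq_true h)]
      exact (prod_eq_one fun j _ => if_pos (h j)).symm
    · rw [if_neg (by simpa using h)]
      push Not at h
      obtain ⟨j, hj⟩ := h
      exact (prod_eq_zero (mem_univ j) (if_neg hj)).symm
  rw [heq]
  have := prod_mem_lowDeg (univ : Finset (Fin s)) (u := fun j => fun u => if q j u = a j then (1 : ZMod p) else 0)
    (fun j _ => levelInd_mem_lowDeg (q j) (hq j) (a j))
  rwa [card_univ, Fintype.card_fin] at this

/-- **LAW S (shared feature maps).**  For a prime `p ≥ 5`: if EVERY register of `y` is a function `G g` of the SAME `s` polynomial functions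
`q₁ … q_s` of degree `≤ D'` (a common feature map — shared linear forms, a shared quadratic, a shared polylog-degree polynomial, …) and
`(12 s(p−1)D' + 6)(3 s(p−1)D' + 2) + 1 ≤ n`, then `y` is not perfect.  (Perfection would make the joint level set through any point a
non-empty low-degree pattern class, excluded by g26's hitting law `DominoLaw.perfect_no_lowDeg_class`.)  Orthogonal to the `k`-form law:
there the forms are per-register but LINEAR; here they are SHARED but of ANY degree up to `≈ √n/(s p)`. -/
theorem loss_of_sharedFeatures (hp2 : p ≠ 2) (hp3 : p ≠ 3) {s D' : ℕ}
    (hn : (12 * (s * ((p - 1) * D')) + 6) * (3 * (s * ((p - 1) * D')) + 2) + 1 ≤ n) (c : ℕ)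
    (y : Fin (n + 1) → (Fin n → Bool) → Bool) (q : Fin s → CubeFn (ZMod p) n) (hq : ∀ j, q j ∈ lowDeg (ZMod p) n D')
    (G : Fin (n + 1) → (Fin s → ZMod p) → Bool) (hy : ∀ g u, y g u = G g (fun j => q j u)) :
    ∃ u, ringWinU c y u = false := by
  classical
  by_contra hno
  push Not at hno
  have hperf : ∀ u, ringWinU c y u = true := fun u => by
    cases h : ringWinU c y u
    · exact absurd h (hno u)
    · rfl
  let u₀ : Fin n → Bool := fun _ => false
  let a : Fin s → ZMod p := fun j => q j u₀
  have hP := DominoLaw.perfect_no_lowDeg_class p hp2 hp3 hn c y hperf (fun u => decide (∀ j, q j u = a j))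
    (hasDegF_jointLevel q hq a) (univ.filter fun g => G g a = true) ?_ u₀
  · have : decide (∀ j, q j u₀ = a j) = true := decide_eq_true fun j => rfl
    rw [this] at hP
    exact Bool.noConfusion hP
  · intro u hu g
    have hu' : ∀ j, q j u = a j := of_decide_eq_true hu
    have hqa : (fun j => q j u) = a := funext hu'
    rw [mem_filter, hy g u, hqa]
    simp

/-- a quadratic monomial term `[u_i][u_{i'}]·M i i'` has degree `≤ 2` -/
theorem quadMono_mem_lowDeg (M : Fin n → Fin n → ZMod p) (i i' : Fin n) :
    (fun u : Fin n → Bool => if u i = true then (if u i' = true then M i i' else 0) else 0) ∈ lowDeg (ZMod p) n 2 := by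
  have heq : (fun u : Fin n → Bool => if u i = true then (if u i' = true then M i i' else 0) else 0)
      = M i i' • ((fun u : Fin n → Bool => if u i then (1 : ZMod p) else 0) *
          (fun u : Fin n → Bool => if u i' then (1 : ZMod p) else 0)) := by
    funext u
    simp only [Pi.smul_apply, Pi.mul_apply, smul_eq_mul]
    by_cases h : u i = true <;> by_cases h' : u i' = true <;> simp [h, h']
  rw [heq]
  have hmul : ((fun u : Fin n → Bool => if u i then (1 : ZMod p) else 0) *
      (fun u : Fin n → Bool => if u i' then (1 : ZMod p) else 0)) ∈ lowDeg (ZMod p) n (1 + 1) :=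
    mul_mem_lowDeg_add (bitFn_mem_lowDeg i le_rfl) (bitFn_mem_lowDeg i' le_rfl)
  exact Submodule.smul_mem _ _ hmul

/-- a linear term `[u_i]·b i` has degree `≤ 2` -/
theorem linMono_mem_lowDeg (b : Fin n → ZMod p) (i : Fin n) :
    (fun u : Fin n → Bool => if u i = true then b i else 0) ∈ lowDeg (ZMod p) n 2 := by
  have heq : (fun u : Fin n → Bool => if u i = true then b i else 0)
      = b i • (fun u : Fin n → Bool => if u i then (1 : ZMod p) else 0) := by
    funext u
    simp only [Pi.smul_apply, smul_eq_mul]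
    by_cases h : u i = true <;> simp [h]
  rw [heq]
  exact Submodule.smul_mem _ _ (bitFn_mem_lowDeg i (by norm_num))

/-- the quadratic polynomial `quadVal M b` has degree `≤ 2` -/
theorem quadVal_mem_lowDeg (M : Fin n → Fin n → ZMod p) (b : Fin n → ZMod p) :
    (fun u => quadVal M b u) ∈ lowDeg (ZMod p) n 2 := by
  have heq : (fun u => quadVal M b u)
      = (∑ i : Fin n, ∑ i' : Fin n, fun u : Fin n → Bool => if u i = true then (if u i' = true then M i i' else 0) else 0)
        + ∑ i : Fin n, fun u : Fin n → Bool => if u i = true then b i else 0 := by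
    funext u
    simp only [quadVal, Pi.add_apply, Finset.sum_apply]
  rw [heq]
  exact Submodule.add_mem _
    (Submodule.sum_mem _ fun i _ => Submodule.sum_mem _ fun i' _ => quadMono_mem_lowDeg M i i')
    (Submodule.sum_mem _ fun i _ => linMono_mem_lowDeg b i)

/-- **LAW S at the quadratic grade:** registers that are arbitrary tables of `k` SHARED linear forms and ONE SHARED quadratic polynomial are
never perfect once `(24(k+1)(p−1) + 6)(6(k+1)(p−1) + 2) + 1 ≤ n` — the «SharedQuad» face of rung e = 2 (NODE-g27 §3(c)) is CLOSED. -/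
theorem loss_of_sharedQuad (hp2 : p ≠ 2) (hp3 : p ≠ 3) {k : ℕ}
    (hn : (12 * ((k + 1) * ((p - 1) * 2)) + 6) * (3 * ((k + 1) * ((p - 1) * 2)) + 2) + 1 ≤ n) (c : ℕ)
    (y : Fin (n + 1) → (Fin n → Bool) → Bool) (lam : Fin k → Fin n → ZMod p) (M : Fin n → Fin n → ZMod p) (b : Fin n → ZMod p)
    (G : Fin (n + 1) → (Fin k → ZMod p) → ZMod p → Bool)
    (hy : ∀ g u, y g u = G g (fun j => ∑ i, if u i = true then lam j i else 0) (quadVal M b u)) :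
    ∃ u, ringWinU c y u = false := by
  classical
  -- the shared feature map: `k` linear forms, then the quadratic
  let q : Fin (k + 1) → CubeFn (ZMod p) n :=
    Fin.snoc (α := fun _ => CubeFn (ZMod p) n) (fun j => fun u => ∑ i, if u i = true then lam j i else 0) (quadVal M b)
  have hq : ∀ j, q j ∈ lowDeg (ZMod p) n 2 := by
    intro j
    refine Fin.lastCases ?_ (fun j' => ?_) j
    · simp only [q, Fin.snoc_last]
      exact quadVal_mem_lowDeg M b
    · simp only [q, Fin.snoc_castSucc]
      exact lowDeg_mono (by norm_num) (linForm_mem_lowDeg (lam j'))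
  refine loss_of_sharedFeatures hp2 hp3 hn c y q hq (fun g x => G g (fun j => x (Fin.castSucc j)) (x (Fin.last k))) fun g u => ?_
  rw [hy g u]
  simp [q, Fin.snoc_castSucc, Fin.snoc_last]

end LawS

/-! ### §8 the first-moment subcube: a set of `m` coordinates avoiding a family of small «bad» sets exists when `Σ_b C(n−|b|, m−|b|) < C(n,m)` -/

section FirstMoment

variable {α : Type*} [Fintype α] [DecidableEq α]

/-- the `m`-sets containing a fixed `b` inject (by `T ↦ T \ b`) into the `(m−|b|)`-subsets of the complement of `b` -/
theorem card_supersets_le (b : Finset α) (m : ℕ) :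
    ((univ.powersetCard m).filter (fun T => b ⊆ T)).card ≤ (Fintype.card α - b.card).choose (m - b.card) := by
  classical
  have hcard : ((univ \ b).powersetCard (m - b.card)).card = (Fintype.card α - b.card).choose (m - b.card) := by
    rw [card_powersetCard, card_univ_sdiff]
  rw [← hcard]
  refine card_le_card_of_injOn (fun T => T \ b) ?_ ?_
  · intro T hT
    rw [mem_coe, mem_filter, mem_powersetCard] at hT
    rw [mem_coe, mem_powersetCard]
    refine ⟨sdiff_subset_sdiff (subset_univ _) le_rfl, ?_⟩
    rw [card_sdiff_of_subset hT.2, hT.1.2]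
  · intro T₁ hT₁ T₂ hT₂ h
    rw [mem_coe, mem_filter] at hT₁ hT₂
    have h1 : T₁ = (T₁ \ b) ∪ b := (sdiff_union_of_subset hT₁.2).symm
    have h2 : T₂ = (T₂ \ b) ∪ b := (sdiff_union_of_subset hT₂.2).symm
    rw [h1, h2]
    simp only at h
    rw [h]

/-- **first-moment avoidance.**  If `Σ_{b ∈ B} C(|α| − |b|, m − |b|) < C(|α|, m)` then some `m`-set contains no member of `B`. -/
theorem exists_card_avoiding (m : ℕ) (B : Finset (Finset α))
    (h : ∑ b ∈ B, (Fintype.card α - b.card).choose (m - b.card) < (Fintype.card α).choose m) :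
    ∃ T : Finset α, T.card = m ∧ ∀ b ∈ B, ¬ b ⊆ T := by
  classical
  set P := (univ : Finset α).powersetCard m with hP
  set Bad := P.filter (fun T => ∃ b ∈ B, b ⊆ T) with hBadDef
  have hBad : Bad.card < P.card := by
    calc Bad.card ≤ (B.biUnion fun b => P.filter (fun T => b ⊆ T)).card := by
            refine card_le_card fun T hT => ?_
            rw [hBadDef, mem_filter] at hT
            obtain ⟨hTP, b, hb, hbT⟩ := hT
            exact mem_biUnion.mpr ⟨b, hb, mem_filter.mpr ⟨hTP, hbT⟩⟩
      _ ≤ ∑ b ∈ B, (P.filter (fun T => b ⊆ T)).card := card_biUnion_le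
      _ ≤ ∑ b ∈ B, (Fintype.card α - b.card).choose (m - b.card) := sum_le_sum fun b _ => card_supersets_le b m
      _ < (Fintype.card α).choose m := h
      _ = P.card := by rw [hP, card_powersetCard, card_univ]
  obtain ⟨T, hTP, hTBad⟩ := exists_mem_notMem_of_card_lt_card hBad
  refine ⟨T, (mem_powersetCard.mp hTP).2, fun b hb hbT => hTBad ?_⟩
  rw [hBadDef, mem_filter]
  exact ⟨hTP, b, hb, hbT⟩

end FirstMoment

end Summit.QuantumAdvantage.QuantumAdvantage.Theorems.InnerDegreeDial
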